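import Mathlib
import Summits.ResolutionOfSingularities.ResolutionOfSingularities.Theorems.RadicialJungCleanModelsContactChainIsoOffPoint
import Summits.ResolutionOfSingularities.ResolutionOfSingularities.Theorems.RadicialJungCleanModelsCleanPermissibleTransport
import Summits.ResolutionOfSingularities.ResolutionOfSingularities.Theorems.EquisingularLiftEquisingularLiftNatNDInvPersists
import HarnessLib

/-!
# Route `RadicialJung`, crux `CleanModels` (stmt-ResolutionOfSingularities-15917), line `Sketch` rev 35, stub 6 `stub_cleanProp44` (X44c),
# work plan O8 / L7b-global, item (G2): a chain of point blow-ups following the curve does not disturb the other points of the curve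

Memo `Cruxes/CleanModels/Lines/Sketch-memo-hand2-g9-stubs-5-7.md` §3a (G2).  Along `IsPointChainAlong σ C₀ C x n` (all centres over the base point
`x₀ = σ x`): (i) set bookkeeping `C ∩ σ⁻¹({x₀}ᶜ) = σ⁻¹(C₀ ∖ {x₀})` (`IsPointChainAlong.inter_preimage_compl`); (ii) at every `y'` with `σ y' ≠ x₀` the
stalk map is an isomorphism (✓ `IsPointChainAlong.isIso_morphismRestrict` + ✓ `isIso_stalkMap_of_isIso_restrict_compl`, EquisingularLift) carrying
`𝓘_{C₀, σ y'}` onto `𝓘_{C, y'}` (✓ `stalkIdeal_vanishingIdeal_closure_eq_map`, ibid.); (iii) hence clean-permissibility of the line for `C₀` at `σ y'` gives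
clean-permissibility of `σ^♯ G` for `C` at `y'` (✓ `CleanPermissibleAt.functionFieldMap_of_isIso_stalkMap`):
`IsPointChainAlong.cleanPermissibleAt_of_ne`.  With L7b (✓ `exists_pointChain_cleanPermissibleAt_of_cleanRegAt`, the base point) this is the induction
step of L7b-global: one bad closed point fewer, no new bad point.

Honest framing: OURS (bookkeeping); nothing here proves X44c, resolution in characteristic `p`, or any case of `CleanModels`.
-/

noncomputable section

set_option linter.dupNamespace false -- mandated namespace of this single-conjunct summit

open CategoryTheory AlgebraicGeometry TopologicalSpace IsLocalRing
open Literature.AlgebraicGeometry.Resolution Literature.AlgebraicGeometry.Motives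
open Scheme.IdealSheafData
open Summit.ResolutionOfSingularities.ResolutionOfSingularities.Cruxes.EquisingularLiftNat.Sections.ND

namespace Summit.ResolutionOfSingularities.ResolutionOfSingularities.Theorems.RadicialJung.CleanModels

universe u

/-- **Set bookkeeping along a chain**: off the (closed) base point the strict transform is the preimage of the curve,
`C ∩ σ⁻¹({σ x}ᶜ) = σ⁻¹(C₀ ∖ {σ x})`. [folklore] -/
theorem IsPointChainAlong.inter_preimage_compl {X₀ X : Scheme.{u}} {σ : X ⟶ X₀} {C₀ : Closeds X₀} {C : Closeds X} {x : X} {n : ℕ}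
    (h : IsPointChainAlong σ C₀ C x n) (hx₀ : IsClosed ({σ x} : Set X₀)) :
    (C : Set X) ∩ σ ⁻¹' {σ x}ᶜ = σ ⁻¹' ((C₀ : Set X₀) \ {σ x}) := by
  induction h with
  | nil C₀ x₀ => ext y; simp
  | cons σ C₀ C n τ x' hx hchain hYreg hτ hx' ih =>
    have hστ : (τ ≫ σ) x' = σ (τ x') := by rw [Scheme.Hom.comp_apply]
    rw [hστ] at hx₀ ⊢
    have ih' := ih hx₀
    -- `W = σ⁻¹ {σ x}ᶜ` (open), `A = τ⁻¹ (C ∖ {x})`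
    set W : Set _ := σ ⁻¹' {σ (τ x')}ᶜ with hW
    have hWopen : IsOpen W := (isOpen_compl_iff.mpr hx₀).preimage σ.continuous
    have hpre : ∀ S : Set X₀, (τ ≫ σ) ⁻¹' S = τ ⁻¹' (σ ⁻¹' S) := fun S => by
      ext y; simp
    have hcompl : (τ ≫ σ) ⁻¹' {σ (τ x')}ᶜ = τ ⁻¹' W := by rw [hpre]
    rw [hcompl, hpre, ← ih']
    -- `A ∩ τ⁻¹ W = τ⁻¹ (C ∩ W)`
    have hAW : τ ⁻¹' ((C : Set _) \ {τ x'}) ∩ τ ⁻¹' W = τ ⁻¹' ((C : Set _) ∩ W) := by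
      ext y
      simp only [Set.mem_inter_iff, Set.mem_preimage, Set.mem_sdiff, Set.mem_singleton_iff, hW, Set.mem_compl_iff]
      constructor
      · rintro ⟨⟨hC, -⟩, hWy⟩; exact ⟨hC, hWy⟩
      · rintro ⟨hC, hWy⟩; exact ⟨⟨hC, fun heq => hWy (by rw [heq])⟩, hWy⟩
    apply le_antisymm
    · intro y hy
      have h1 : y ∈ closure (τ ⁻¹' ((C : Set _) \ {τ x'}) ∩ τ ⁻¹' W) :=
        (hWopen.preimage τ.continuous).closure_inter hy
      rw [hAW] at h1
      have h2 : y ∈ τ ⁻¹' (C : Set _) :=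
        (C.isClosed.preimage τ.continuous).closure_subset (closure_mono (fun z hz => hz.1) h1)
      exact ⟨h2, hy.2⟩
    · intro y hy
      have hy' : y ∈ τ ⁻¹' ((C : Set _) \ {τ x'}) ∩ τ ⁻¹' W := by rw [hAW]; exact hy
      exact ⟨subset_closure hy'.1, hy'.2⟩

/-- **Off the base point a chain does not disturb the curve**: for `y'` with `σ y' ≠ σ x` (the base point closed), the stalk map of the chain at
`y'` is an isomorphism carrying `𝓘_{C₀, σ y'}` onto `𝓘_{C, y'}`. [folklore] -/
theorem IsPointChainAlong.stalkIdeal_eq_map_of_ne {X₀ X : Scheme.{0}} {σ : X ⟶ X₀} {C₀ : Closeds X₀} {C : Closeds X} {x : X} {n : ℕ}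
    (h : IsPointChainAlong σ C₀ C x n) (hx₀ : IsClosed ({σ x} : Set X₀)) (y' : X) (hy : σ y' ≠ σ x) :
    IsIso (σ.stalkMap y') ∧
      stalkIdeal (vanishingIdeal C) y' = (stalkIdeal (vanishingIdeal C₀) (σ y')).map (σ.stalkMap y').hom := by
  haveI : IsIso (σ ∣_ (⟨{σ x}ᶜ, hx₀.isOpen_compl⟩ : X₀.Opens)) := h.isIso_morphismRestrict _ (fun hmem => hmem rfl)
  refine ⟨isIso_stalkMap_of_isIso_restrict_compl σ (σ x) hx₀ y' hy, ?_⟩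
  have hbook : (C : Set X) ∩ σ ⁻¹' {σ x}ᶜ = σ ⁻¹' ((C₀ : Set X₀) \ {σ x}) := h.inter_preimage_compl hx₀
  have key := stalkIdeal_vanishingIdeal_closure_eq_map σ (σ x) hx₀ (C₀ : Set X₀) (C : Set X) C.isClosed hbook y' hy
  have hC : (⟨closure (C : Set X), isClosed_closure⟩ : Closeds X) = C := Closeds.ext C.isClosed.closure_eq
  have hC₀ : (⟨closure (C₀ : Set X₀), isClosed_closure⟩ : Closeds X₀) = C₀ := Closeds.ext C₀.isClosed.closure_eq
  rw [hC, hC₀] at key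
  exact key

/-- **(G2)**: clean-permissibility of the line for `C₀` at a point `σ y' ≠ σ x` of the curve is carried by the chain to clean-permissibility of
`σ^♯ G` for the strict transform `C` at `y'`. [cite: Piltant2013, §2 Axiom 4] [cite: GortzWedhorn2020, Prop. 13.91 (3)] -/
theorem IsPointChainAlong.cleanPermissibleAt_of_ne {X₀ X : Scheme.{0}} [IsIntegral X₀] [IsIntegral X] {σ : X ⟶ X₀} [IsDominant σ]
    {C₀ : Closeds X₀} {C : Closeds X} {x : X} {n : ℕ} (h : IsPointChainAlong σ C₀ C x n) (hx₀ : IsClosed ({σ x} : Set X₀))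
    (p : ℕ) (G : X₀.functionField) (y' : X) (hy : σ y' ≠ σ x)
    (hperm : CleanPermissibleAt p (RatFn.toFunctionField (σ y')) G (stalkIdeal (vanishingIdeal C₀) (σ y'))) :
    CleanPermissibleAt p (RatFn.toFunctionField y') (RatFn.functionFieldMap σ G) (stalkIdeal (vanishingIdeal C) y') := by
  obtain ⟨hiso, hid⟩ := h.stalkIdeal_eq_map_of_ne hx₀ y' hy
  haveI := hiso
  have key := hperm.functionFieldMap_of_isIso_stalkMap σ y' (vanishingIdeal C₀)
  rw [stalkIdeal_comap_eq_map, ← hid] at key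
  exact key

end Summit.ResolutionOfSingularities.ResolutionOfSingularities.Theorems.RadicialJung.CleanModels

end
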